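/-
Copyright (c) 2026 the pub-hodgecm-mathlib formalisation cell (harness21).  Prover seat hodgecm-mathlib-K2E5-p15 (g2), Track B «K2-LIT» ∕ h413 = `stmt-HodgeConjecture-24833`,
engine E5 «TamagawaUnitary», unit G «ZETA»: organ (E1a), letter asked by K2E5-p10 (g3) for (E4) (REPORT-FIRST 2026-09-04T01:29:10Z).  2026-09-04.
-/
import Summits.HodgeConjecture.HodgeConjecture.Theorems.K2E5QuatComparisonIntegrandSplit      -- ★ (E1a) (p856538, this seat): (M∞) `quatModule_quatArchToAdelic` in `ringEquiv_mixedSpace` letters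
import Literature.NumberTheory.Automorphic.UnitaryGroupArchToAdelicPlaces                     -- ★ `extensionEmbedding_ringEquiv_mixedSpace_symm` (the complex coordinates of `e⁻¹` ARE the `σ_w`)
import HarnessLib

/-!
# K2 ∕ E5 «TamagawaUnitary», unit G «ZETA» — organ (E1a), archimedean letter: `‖(y, 1)‖ = ∏_w ‖y_w‖_w` place by place

Cell `hodgecm-mathlib` (Track B «K2-LIT»), item h413 = `stmt-HodgeConjecture-24833`; seat K2E5-p15 (g2), (E1a) `K2E5QuatComparisonIntegrandSplit` (★ p856538) — the ONE LETTER
asked by K2E5-p10 (g3) for the archimedean evaluation (E4) `K2E5QuatArchZetaLimit` (REPORT-FIRST 2026-09-04T01:29:10Z): the module of an archimedean element `(y, 1_f)` of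
`(D_h ⊗ 𝔸)^×` (★ #3g `quatModule = |det|_{𝔸_L}`) is the product over the COMPLEX places `w` of the CM field `L` of ★ K2E5-p22's per-place modules
★ `quatArchModulus (y_w) = |det y_w|²_ℂ` of the components `y_w = quatArchPiEquiv y w ∈ (D_{h,w})^×` (★ #3m `K2E5QuatArchPlaces`).  PROOF lane (theorems only; no `def`,
no instance, no notation, no `sorry`; `--supports stmt-HodgeConjecture-24833 --as helper`).  Road: ★ (E1a) (M∞) `quatModule_quatArchToAdelic` gives
`∏_{w ∣ ∞} ‖(e⁻¹ det y)_w‖^{mult w}` (`e = InfiniteAdeleRing.ringEquiv_mixedSpace`); a CM field is totally complex (Mathlib `IsCMField.isTotallyComplex`), so every `mult w = 2`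
and the index set is `{w // IsComplex w}`; `‖(e⁻¹ m)_w‖ = ‖m_w‖_ℂ` because Mathlib's `Completion.extensionEmbedding w` is an isometry whose composite with `e⁻¹` is the
`w`-coordinate (★ `extensionEmbedding_ringEquiv_mixedSpace_symm`); `(det y)_w = det (y_w)` (Mathlib `RingHom.map_det`, ★ `coe_quatArchAt`); `‖z‖² = normSq z`.

Sources: [WeilBNT1967] A. Weil, *Basic Number Theory*, Ch. IV §4 (module of an idele = product of local modules; `mod_ℂ(z) = z z̄`); [CasselsFrohlichANT1967] Ch. II §16;
[VignerasLNM800] Ch. II §4 (`‖x‖_v = |n(x)|_v²` at a complex place), Ch. III §1; [BorelJacquet1979] §4.1 (`G_∞ = ∏_{w ∣ ∞} G(F_w)`).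
HONEST LABEL: HC_CM is proved only modulo the 7 printed citations (2 remaining named inputs: hLiu418 = stmt-HodgeConjecture-24832, h413 = stmt-HodgeConjecture-24833) until rung 0
closes; count-neutral helper (closes no socket by itself).
-/

set_option autoImplicit false
set_option linter.dupNamespace false

noncomputable section

open NumberField NumberField.InfinitePlace NumberField.mixedEmbedding IsDedekindDomain
open Literature.NumberTheory.Automorphic Literature.NumberTheory.Automorphic.UnitaryGroup
open Summit.HodgeConjecture.HodgeConjecture.Cruxes.H413.K2E5QuatAdelicMatrixModel
open Summit.HodgeConjecture.HodgeConjecture.Cruxes.H413.K2E5QuatZeta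
open Summit.HodgeConjecture.HodgeConjecture.Cruxes.H413.K2E5QuatAdelicProdDecomposition
open Summit.HodgeConjecture.HodgeConjecture.Cruxes.H413.K2E5QuatArchLocal
open Summit.HodgeConjecture.HodgeConjecture.Cruxes.H413.K2E5QuatArchPlaces
open Summit.HodgeConjecture.HodgeConjecture.Cruxes.H413.K2E5QuatComparisonIntegrandSplit
open scoped Matrix MatrixGroups NNReal Classical

namespace Summit.HodgeConjecture.HodgeConjecture.Cruxes.H413.K2E5QuatArchModuleFactor

variable (L : Type) [Field L] [NumberField L] [IsCMField L] {Ha : Matrix (Fin 2) (Fin 2) L}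

omit [IsCMField L] in
/-- **`‖(e⁻¹ m)_w‖ = ‖m_w‖_ℂ` at a complex place `w`** (`e = InfiniteAdeleRing.ringEquiv_mixedSpace L`): Mathlib's `Completion.extensionEmbedding w : L_w →+* ℂ` is an isometry and
its composite with `e⁻¹` is the `w`-coordinate of the mixed space (★ `extensionEmbedding_ringEquiv_mixedSpace_symm`). [cite: CasselsFrohlichANT1967, Ch. II §16] -/
theorem norm_ringEquiv_mixedSpace_symm_apply (m : mixedSpace L) (w : {w : InfinitePlace L // IsComplex w}) :
    ‖((InfiniteAdeleRing.ringEquiv_mixedSpace L).symm m) w.1‖ = ‖m.2 w‖ := by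
  rw [← (Completion.isometry_extensionEmbedding w.1).norm_map_of_map_zero (map_zero _) (((InfiniteAdeleRing.ringEquiv_mixedSpace L).symm m) w.1),
    extensionEmbedding_ringEquiv_mixedSpace_symm L m w]

/-- **`(det y)_w = det (y_w)`**: the `w`-coordinate of the determinant of `y ∈ (D_h ⊗ ℝ)^×` is the determinant of its `w`-component `quatArchPiEquiv y w = GL₂(evalC w) y`
(Mathlib `RingHom.map_det`, ★ `coe_quatArchAt`). [cite: BorelJacquet1979, §4.1] -/
theorem det_snd_apply_eq_det_quatArchPiEquiv (y : ↥(quatArchUnits L Ha)) (w : {w : InfinitePlace L // IsComplex w}) :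
    ((y : GL (Fin 2) (mixedSpace L)).val.det).2 w = (((quatArchPiEquiv L Ha y w : ↥(quatArchLocalUnits L Ha w)) : GL (Fin 2) ℂ) : Matrix (Fin 2) (Fin 2) ℂ).det := by
  rw [quatArchPiEquiv_apply, coe_quatArchAt, ← evalC_apply L w, RingHom.map_det]
  rfl

/-- **THE LETTER FOR (E4): `‖(y, 1)‖ = ∏_{w complex} ‖y_w‖_w`** — the module (★ #3g `quatModule = |det|_{𝔸_L}`) of the archimedean element `quatArchToAdelic y = (y, 1_f)` of `(D_h ⊗ 𝔸)^×`
is the product over the complex places `w` of the CM field `L` of the per-place modules ★ `quatArchModulus (y_w) = |det y_w|²` of its components `y_w = quatArchPiEquiv y w ∈ (D_{h,w})^×`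
(★ (E1a) (M∞) `quatModule_quatArchToAdelic`; `L` totally complex so `mult w = 2` at every place; `‖(e⁻¹ det y)_w‖ = |det y_w|_ℂ`).
[cite: WeilBNT1967, Ch. IV §4] [cite: VignerasLNM800, Ch. II §4; Ch. III §1] [cite: BorelJacquet1979, §4.1] -/
theorem coe_quatModule_quatArchToAdelic (y : ↥(quatArchUnits L Ha)) :
    (quatModule L Ha (quatArchToAdelic L Ha y) : ℝ) =
      ∏ w : {w : InfinitePlace L // IsComplex w}, quatArchModulus (((quatArchPiEquiv L Ha y w : ↥(quatArchLocalUnits L Ha w)) : GL (Fin 2) ℂ) : Matrix (Fin 2) (Fin 2) ℂ) := by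
  rw [quatModule_quatArchToAdelic, NNReal.coe_prod]
  refine (Fintype.prod_equiv (Equiv.subtypeUnivEquiv fun w : InfinitePlace L => IsTotallyComplex.isComplex w)
    (fun w : {w : InfinitePlace L // IsComplex w} =>
      quatArchModulus (((quatArchPiEquiv L Ha y w : ↥(quatArchLocalUnits L Ha w)) : GL (Fin 2) ℂ) : Matrix (Fin 2) (Fin 2) ℂ))
    (fun w : InfinitePlace L =>
      ((‖(InfiniteAdeleRing.ringEquiv_mixedSpace L).symm ((y : GL (Fin 2) (mixedSpace L)).val.det) w‖₊ ^ w.mult : ℝ≥0) : ℝ))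
    fun w => ?_).symm
  rw [Equiv.subtypeUnivEquiv_apply, NNReal.coe_pow, coe_nnnorm, mult_isComplex, norm_ringEquiv_mixedSpace_symm_apply L _ w,
    det_snd_apply_eq_det_quatArchPiEquiv L y w, quatArchModulus_apply, Complex.normSq_eq_norm_sq]

/-- The same in `ℝ≥0` letters (★ #3g `quatModule` is `ℝ≥0`-valued): `‖(y, 1)‖ = ∏_w ⟨‖y_w‖_w, _⟩`, stated through `Real.toNNReal` of the (non-negative) real product.
[cite: WeilBNT1967, Ch. IV §4] -/
theorem quatModule_quatArchToAdelic_eq_toNNReal_prod (y : ↥(quatArchUnits L Ha)) :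
    quatModule L Ha (quatArchToAdelic L Ha y) =
      (∏ w : {w : InfinitePlace L // IsComplex w}, quatArchModulus (((quatArchPiEquiv L Ha y w : ↥(quatArchLocalUnits L Ha w)) : GL (Fin 2) ℂ) : Matrix (Fin 2) (Fin 2) ℂ)).toNNReal := by
  rw [← coe_quatModule_quatArchToAdelic, Real.toNNReal_coe]

end Summit.HodgeConjecture.HodgeConjecture.Cruxes.H413.K2E5QuatArchModuleFactor

end
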